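import Summits.BirchSwinnertonDyer.BirchSwinnertonDyer.Theorems.ErratumRoadFiveIMCDivAtomsB
import Summits.BirchSwinnertonDyer.BirchSwinnertonDyer.Theorems.ErratumRoadFiveIMCDivRung5235a1
import Summits.BirchSwinnertonDyer.BirchSwinnertonDyer.Theorems.ErratumRoadFiveIMCDivSplitRung5385b1
import HarnessLib

/-!
# Route `ErratumRoadFive` (rung K2, `p ≥ 5`), crux `IMCDivAtErratumDataAll` (item stmt-BirchSwinnertonDyer-19270, H3♭):
# the two landed UNIT RUNGS re-read for the RE-ORIENTED slice `P2.IMCDivIntCoreFrameAtDiscrB` (X-slot at the OTHER prime)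

Cell `bsd-stepL` (run/shared/lean/pub/bsd-stepL/), seat `bsd-stepL-imc24b` (prover g4, 2026-08-27); `--supports
stmt-BirchSwinnertonDyer-19270 --as helper`. Q4 (c) of `HOME/audit/ORIENT-AUDIT-19270-imc-p1-g8.md` and plan g30 RULING 2 (G1):
«the landed rung `stub_rung_imcDivErratum_5235a1_d231` (unit pair: `Q` a unit, divisibility `≤ ⊤`) holds for `…AtDiscrᴮ` by the
same one-line proof (ι-blind)».

At a UNIT erratum datum the printed ♭-frame is a unit of `𝓞_{ℂ_p}⟦T⟧` (imc-p1's `P2.exists_unitFrame_of_thm32_of_unitValue`), so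
the divisibility conjunct holds for EVERY X-slot (this seat's `P2.exists_unitFrame_forall_slot_of_thm32_of_unitValue`, p492587):
the two unit rungs of the crux — imc-p1's NON-split pair `(5235a1, 5)` at `d = −231` (the REGISTERED BC5 rung of skeleton v3,
p465857) and this seat's SPLIT pair `(5385b1, 5)` at its unit discriminants (p461565, the regime of stub S2
`stub_imcDivErratum_splitAtP`) — re-read VERBATIM (same `h32`, same attested certificate binder) for the re-oriented slice
`P2.IMCDivIntCoreFrameAtDiscrB`, by `P2.imcDivIntCoreFrameAtDiscrB_of_thm32_of_unitCertAtDiscr` with the kernel facts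
`Rung5235a1.semistable` ∕ `SplitRung5385b1.semistable`. These are the BC5 ∕ fit-witness candidates for the planner's repaired item
(`IMCDivAtErratumDataAllR := ∀ W p, P2.IMCDivIntCoreFrameAtErratumDataB W p`): its per-discriminant rung stub can be registered
as `… (h32) (hunit) : P2.IMCDivIntCoreFrameAtDiscrB E 5 (−231)` and closed by §1 by name.

HONEST FRAMING: theorems only (0 defs, 0 named facts, 0 `sorry`); CONDITIONAL on `h32` (Castella 2018 Thms. 3.1–3.2, PUBLISHED)
and the ATTESTED unit certificates (kit j255217 for `(5235a1, 5, −231)`; kit j257281 ∕ j257458 for `(5385b1, 5, d ∈ {−39, −159,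
−231})`); one curve and one discriminant each; nothing booked; closes no item; BSD proved for no pair; the anticyclotomic main
conjecture asserted nowhere.

References: [Castella2018] Thm. 3.1, display (3.2), Thm. 3.2 (arXiv:1704.06608 p. 9); [Castella2018Erratum] (2.4) (p. 4);
[Cremona1997] Table 1 (curves 5235a1, 5385b1).
-/

noncomputable section

open scoped Classical

set_option linter.dupNamespace false

namespace Summit.BirchSwinnertonDyer.BirchSwinnertonDyer.Theorems.AtomsBRungs

open WeierstrassCurve NumberField IsDedekindDomain Field
open Literature.NumberTheory.EllipticCurves Literature.NumberTheory.EllipticCurves.GreenbergSelmer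
open Literature.NumberTheory.EllipticCurves.ModularForms
open Literature.NumberTheory.EllipticCurves.Rank1Residual
open Literature.NumberTheory.EllipticCurves.Rank1Residual.Typed
open Literature.NumberTheory.EllipticCurves.Castella2018
open Literature.NumberTheory.GaloisRepresentations
open Literature.NumberTheory.GaloisCohomology
open Summit.BirchSwinnertonDyer.Rank1Residual Summit.BirchSwinnertonDyer.Rank1Residual.X11b
open Summit.BirchSwinnertonDyer.Rank1Residual.X11b.Halves Summit.BirchSwinnertonDyer.Rank1Residual.X11b.AcSelmer

/-! ## §1 The REGISTERED non-split rung `(5235a1, 5, −231)` re-read for the B-slice -/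

/-- **The BC5 rung of crux 19270 at the unit pair `E = 5235a1` (NON-split multiplicative `5`), `d = −231`, RE-ORIENTED**:
the binders of `Rung5235a1.stub_rung_imcDivErratum_5235a1_d231` VERBATIM (`h32` = Castella 2018 Thms. 3.1–3.2, PUBLISHED;
`hunit` = the attested 5-adic unit certificate at `d = −231`, kit j255217) now conclude the re-oriented slice
`P2.IMCDivIntCoreFrameAtDiscrB E 5 (−231)` — the unit frame makes the divisibility trivial for every X-slot (ι-blind).
CONDITIONAL on both binders; one curve, one discriminant; closes no item.
[cite: Castella2018, Thms. 3.1–3.2 (arXiv:1704.06608 p. 9)] [cite: Castella2018Erratum, (2.4) (p. 4)] [cite: Cremona1997, Table 1 (curve 5235a1)] -/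
theorem rung_imcDivErratumB_5235a1_d231 [((⟨1, 1, 0, -113, -552⟩ : WeierstrassCurve ℤ).baseChange ℚ).IsElliptic] [((⟨1, 1, 0, -113, -552⟩ : WeierstrassCurve ℤ).baseChange ℚ).IsGloballyMinimal]
    (h32 : thm32_exists_isBDPLFunction_valueAtOne)
    (hunit : ∀ [NeZero (((⟨1, 1, 0, -113, -552⟩ : WeierstrassCurve ℤ).baseChange ℚ).conductorNorm ℤ)] (q : ℕ) [Fact q.Prime] (K : Type) [Field K] [NumberField K]
      (Dt : ModularParametrizationData ((⟨1, 1, 0, -113, -552⟩ : WeierstrassCurve ℤ).baseChange ℚ) (((⟨1, 1, 0, -113, -552⟩ : WeierstrassCurve ℤ).baseChange ℚ).conductorNorm ℤ))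
      (H : HeegnerDatum (((⟨1, 1, 0, -113, -552⟩ : WeierstrassCurve ℤ).baseChange ℚ).conductorNorm ℤ) (NumberField.discr K)) (w₀ : InfinitePlace K)
      (P : (((⟨1, 1, 0, -113, -552⟩ : WeierstrassCurve ℤ).baseChange ℚ).baseChange K).toAffine.Point), ErratumHypotheses ((⟨1, 1, 0, -113, -552⟩ : WeierstrassCurve ℤ).baseChange ℚ) 5 → ((⟨1, 1, 0, -113, -552⟩ : WeierstrassCurve ℤ).baseChange ℚ).analyticRank = 1 →
      q ≠ 5 → Mult ((⟨1, 1, 0, -113, -552⟩ : WeierstrassCurve ℤ).baseChange ℚ) q → ¬ ((⟨1, 1, 0, -113, -552⟩ : WeierstrassCurve ℤ).baseChange ℚ).HasSplitMultiplicativeReductionAtPrime q →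
      ¬ 5 ∣ padicValInt q ((⟨1, 1, 0, -113, -552⟩ : WeierstrassCurve ℤ).baseChange ℚ).minimalDiscriminantInt → IsErratumField ((⟨1, 1, 0, -113, -552⟩ : WeierstrassCurve ℤ).baseChange ℚ) K q → NumberField.discr K = -231 →
      Cas20Standing K 5 (((⟨1, 1, 0, -113, -552⟩ : WeierstrassCurve ℤ).baseChange ℚ).conductorNorm ℤ / 5) →
      WeierstrassCurve.Affine.Point.map w₀.embedding.toRatAlgHom P = heegnerPointComplex Dt H →
      ¬ (5 : ℤ) ∣ Dt.c → ¬ IsOfFinAddOrder P →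
      ∀ (κ : ZpExtension K 5), κ.IsAnticyclotomic →
        ∀ (γ : Field.absoluteGaloisGroup K) [Fact (κ.IsTopGenerator γ)] (ι' : PadicAlgCl 5 ≃+* ℂ)
          (e : K →+* ℚ_[5]),
          (∀ k : 𝓞 K, k ∈ (primeOfEmbeddingDatum 5 ι' w₀.embedding).asIdeal ↔ ‖e (k : K)‖ < 1) →
          ‖((1 : ℚ_[5]) - (((⟨1, 1, 0, -113, -552⟩ : WeierstrassCurve ℤ).baseChange ℚ).LFunction 5 : ℚ_[5]) * (5 : ℚ_[5])⁻¹) *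
            logOmega ((⟨1, 1, 0, -113, -552⟩ : WeierstrassCurve ℤ).baseChange ℚ) 5 e P‖ = 1) :
    Summit.BirchSwinnertonDyer.Rank1Residual.X11b.P2.IMCDivIntCoreFrameAtDiscrB
      ((⟨1, 1, 0, -113, -552⟩ : WeierstrassCurve ℤ).baseChange ℚ) 5 (-231) :=
  P2.imcDivIntCoreFrameAtDiscrB_of_thm32_of_unitCertAtDiscr h32 Rung5235a1.semistable hunit

/-! ## §2 The SPLIT unit rung `(5385b1, 5)` re-read for the B-slice (the regime of stub S2) -/

/-- **The SPLIT unit rung of crux 19270 at `E = 5385b1` (`a₅ = +1`, split multiplicative `5`), RE-ORIENTED, at any of its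
unit discriminants `d`**: the binders of `SplitRung5385b1.imcDivIntCoreFrameAtDiscr_5385b1_5_of_thm32_of_unitCert` VERBATIM
(`h32` PUBLISHED; `hunit` = the attested unit certificate at `d`, kit j257281 ∕ j257458 for `d ∈ {−39, −159, −231}`) now conclude
`P2.IMCDivIntCoreFrameAtDiscrB E 5 d`. So the regime of the registered stub S2 (`W.HasSplitMultiplicativeReductionAtPrime p`,
here `SplitRung5385b1.split_five`) is inhabited and certifiable under the REPAIRED atom exactly as under the registered one —
the unit rungs are ι-blind. CONDITIONAL on both binders; one curve; closes no item.
[cite: Castella2018, Thms. 3.1–3.2 (arXiv:1704.06608 p. 9)] [cite: Castella2018Erratum, (2.4) (p. 4)] [cite: Cremona1997, Table 1 (curve 5385b1)] -/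
theorem rung_imcDivErratumB_5385b1 [((⟨1, 1, 0, -37, 136⟩ : WeierstrassCurve ℤ).baseChange ℚ).IsElliptic] [((⟨1, 1, 0, -37, 136⟩ : WeierstrassCurve ℤ).baseChange ℚ).IsGloballyMinimal]
    (h32 : thm32_exists_isBDPLFunction_valueAtOne) {d : ℤ}
    (hunit : ∀ [NeZero (((⟨1, 1, 0, -37, 136⟩ : WeierstrassCurve ℤ).baseChange ℚ).conductorNorm ℤ)] (q : ℕ) [Fact q.Prime] (K : Type) [Field K] [NumberField K]
      (Dt : ModularParametrizationData ((⟨1, 1, 0, -37, 136⟩ : WeierstrassCurve ℤ).baseChange ℚ) (((⟨1, 1, 0, -37, 136⟩ : WeierstrassCurve ℤ).baseChange ℚ).conductorNorm ℤ))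
      (H : HeegnerDatum (((⟨1, 1, 0, -37, 136⟩ : WeierstrassCurve ℤ).baseChange ℚ).conductorNorm ℤ) (NumberField.discr K)) (w₀ : InfinitePlace K)
      (P : (((⟨1, 1, 0, -37, 136⟩ : WeierstrassCurve ℤ).baseChange ℚ).baseChange K).toAffine.Point), ErratumHypotheses ((⟨1, 1, 0, -37, 136⟩ : WeierstrassCurve ℤ).baseChange ℚ) 5 → ((⟨1, 1, 0, -37, 136⟩ : WeierstrassCurve ℤ).baseChange ℚ).analyticRank = 1 →
      q ≠ 5 → Mult ((⟨1, 1, 0, -37, 136⟩ : WeierstrassCurve ℤ).baseChange ℚ) q → ¬ ((⟨1, 1, 0, -37, 136⟩ : WeierstrassCurve ℤ).baseChange ℚ).HasSplitMultiplicativeReductionAtPrime q →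
      ¬ 5 ∣ padicValInt q ((⟨1, 1, 0, -37, 136⟩ : WeierstrassCurve ℤ).baseChange ℚ).minimalDiscriminantInt → IsErratumField ((⟨1, 1, 0, -37, 136⟩ : WeierstrassCurve ℤ).baseChange ℚ) K q → NumberField.discr K = d →
      Cas20Standing K 5 (((⟨1, 1, 0, -37, 136⟩ : WeierstrassCurve ℤ).baseChange ℚ).conductorNorm ℤ / 5) →
      WeierstrassCurve.Affine.Point.map w₀.embedding.toRatAlgHom P = heegnerPointComplex Dt H →
      ¬ (5 : ℤ) ∣ Dt.c → ¬ IsOfFinAddOrder P →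
      ∀ (κ : ZpExtension K 5), κ.IsAnticyclotomic →
        ∀ (γ : Field.absoluteGaloisGroup K) [Fact (κ.IsTopGenerator γ)] (ι' : PadicAlgCl 5 ≃+* ℂ)
          (e : K →+* ℚ_[5]),
          (∀ k : 𝓞 K, k ∈ (primeOfEmbeddingDatum 5 ι' w₀.embedding).asIdeal ↔ ‖e (k : K)‖ < 1) →
          ‖((1 : ℚ_[5]) - (((⟨1, 1, 0, -37, 136⟩ : WeierstrassCurve ℤ).baseChange ℚ).LFunction 5 : ℚ_[5]) * (5 : ℚ_[5])⁻¹) *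
            logOmega ((⟨1, 1, 0, -37, 136⟩ : WeierstrassCurve ℤ).baseChange ℚ) 5 e P‖ = 1) :
    Summit.BirchSwinnertonDyer.Rank1Residual.X11b.P2.IMCDivIntCoreFrameAtDiscrB
      ((⟨1, 1, 0, -37, 136⟩ : WeierstrassCurve ℤ).baseChange ℚ) 5 d :=
  P2.imcDivIntCoreFrameAtDiscrB_of_thm32_of_unitCertAtDiscr h32 SplitRung5385b1.semistable hunit

-- S2's regime under the repaired atom is inhabited: the split pair `(5385b1, 5)` carries the S2 premise AND the crux's
-- `ErratumHypotheses` in the kernel — `SplitRung5385b1.hasSplit_and_erratumHypotheses_5385b1_5` (p461565), cited by name.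

end Summit.BirchSwinnertonDyer.BirchSwinnertonDyer.Theorems.AtomsBRungs

end
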